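import Literature.AlgebraicGeometry.HodgeTheory.HypersurfaceResidueFormulaLocal
import Literature.NumberTheory.Transcendental.ComplexFormsPullback
import HarnessLib

/-!
# Diagonal symmetries of a projective model: action on the lifts and on the local residue forms

Family `hodge`, layer `Literature/AlgebraicGeometry/HodgeTheory`. PROOF FILE (theorems only; no
definition, no named fact — D-0026). Setting of `HypersurfaceResidueFormDef`: a manifold `M`
charted on the complex normed space `E`, a map `ψ : M → ℙ ℂ ℂ^{m+2}`, the lifts
`Z̃ᵢ = projLift ψ i` through the standard charts and the local residue forms
`residueFormula ψ F P i j x = P(Z̃ᵢ x) · det(N_j(Z̃ᵢ x), Z̃ᵢ x, dZ̃ᵢ(x) ·)`. A **diagonal symmetry**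
of the model is a self-map `Φ : M → M` lying over `[z] ↦ [a • z]` for a vector of units `a`:
`ψ (Φ x) = [a • z̃]` for `ψ x = [z̃]` (on the Fermat variety: `g_a`, `a ∈ μₘⁿ⁺²`, Shioda 1979 §1;
tree: `hypersurfacePoint_diagonalMap`, `FermatSurfaceEigenformsOnModels`). This file computes its
action on the residue data:

* `projLift_eq_of_mk_eq` — the lift `Z̃ᵢ y` is the unique representative of `ψ y` with `i`-th
  coordinate `1`;
* `mem_liftDomain_symm`, `projLift_symm` — `Φ` preserves `Mᵢ = ψ⁻¹(Uᵢ)` and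
  **`Z̃ᵢ (Φ x) = (a/aᵢ) · Z̃ᵢ x`** (coordinatewise product with `a_j/a_i`);
* `liftDeriv_symm_apply` — for `Φ` holomorphic, **`dZ̃ᵢ(Φ x) ∘ dΦ(x) = (a/aᵢ) · dZ̃ᵢ(x)`** (chain
  rule, the two sides being the differential of `Z̃ᵢ ∘ Φ = (a/aᵢ) · Z̃ᵢ` near `x`);
* `coneResidue_diag` — `det(δN, δz, δL ·) = (∏ δ_j) det(N, z, L ·)` for a coordinatewise scaling
  `δ` (`det (A · diag δ) = det A · ∏ δ_j`);
* `pullback_residueFormula_one_symm` — hence, when moreover the normal vector scales as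
  `N_j(δ z) = δ N_j(z)` (true for the Fermat form and `δ ∈ μₘⁿ⁺²`), **`Φ^* ω = (∏_j a_j/a_i) • ω`
  at `x`** for the `m`-form `ω = det(N_j, Z̃ᵢ, dZ̃ᵢ ·)` on `Mᵢ` — in print
  `g_a^* (dy₁ ∧ ⋯ / (∂f/∂y_j)) = (∏ a_j/a_i) · (dy₁ ∧ ⋯/(∂f/∂y_j))`, `y = x/x_i`;
* `ratio_symm` — the bookkeeping for EIGENFORMS: if `η = f · ω` pointwise on a `Φ`-stable set
  where `ω ≠ 0`, `Φ^*η = χ η` and `Φ^*ω = c ω` there, then `f (Φ x) · c = χ · f x`.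

## References

* [Shioda1979HodgeFermat] T. Shioda, The Hodge conjecture for Fermat varieties, Math. Ann. 245
  (1979) 175–184, §1 (the action of `μₘⁿ⁺²` and (1.7)).
* [VoisinHodgeII2003] C. Voisin, Hodge Theory and Complex Algebraic Geometry II (2003), §6.1.3.
-/

noncomputable section

open scoped Manifold ContDiff Topology LinearAlgebra.Projectivization
open Set Filter Projectivization

namespace Literature.AlgebraicGeometry.HodgeTheory

open Literature.NumberTheory.Transcendental Literature.Geometry.Kaehler

/-! ### The cone residue under a coordinatewise scaling -/

section Cone

variable {m : ℕ} {E : Type*} [NormedAddCommGroup E] [NormedSpace ℂ E]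

/-- **`det(δN, δz, δL v₁, …) = (∏ δ_j) · det(N, z, L v₁, …)`**: scaling every row coordinatewise
by `δ` multiplies the matrix on the right by `diag δ`. [folklore] -/
theorem coneResidue_diag (δ N z : Fin (m + 2) → ℂ) (L T : E →L[ℂ] (Fin (m + 2) → ℂ))
    (hT : ∀ v, T v = δ * L v) : coneResidue (δ * N) (δ * z) T = (∏ j, δ j) • coneResidue N z L := by
  ext v
  rw [ContinuousAlternatingMap.smul_apply, coneResidue_apply, coneResidue_apply, smul_eq_mul]
  have hM : Matrix.of (Matrix.vecCons (δ * N) (Matrix.vecCons (δ * z) fun i ↦ T (v i))) =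
      Matrix.of (Matrix.vecCons N (Matrix.vecCons z fun i ↦ L (v i))) * Matrix.diagonal δ := by
    ext r c
    rw [Matrix.mul_diagonal, Matrix.of_apply, Matrix.of_apply]
    refine Fin.cases ?_ (fun r' ↦ Fin.cases ?_ (fun k ↦ ?_) r') r
    · simp [mul_comm]
    · simp [mul_comm]
    · simp [hT, mul_comm]
  rw [hM, Matrix.det_mul, Matrix.det_diagonal, mul_comm]

end Cone

section Model

variable {m : ℕ} {E : Type*} [NormedAddCommGroup E] [NormedSpace ℂ E]
  {M : Type*} [TopologicalSpace M] [ChartedSpace E M]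
  (ψ : M → ℙ ℂ (Fin (m + 2) → ℂ))

/-! ### The lift is the representative normalised at `i` -/

omit [TopologicalSpace M] [ChartedSpace E M] in
/-- **Uniqueness of the normalised representative**: if `[v] = ψ y` and `v i = 1` then
`Z̃ᵢ y = v` (and `y ∈ Mᵢ`). [folklore] -/
theorem projLift_eq_of_mk_eq {i : Fin (m + 2)} {y : M} {v : Fin (m + 2) → ℂ} (hv : v ≠ 0)
    (hmk : Projectivization.mk ℂ v hv = ψ y) (hvi : v i = 1) :
    y ∈ liftDomain ψ i ∧ projLift ψ i y = v := by
  have hy : y ∈ liftDomain ψ i := by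
    rw [mem_liftDomain_iff, stdChart_source, ← hmk, mk_mem_stdChartSource_iff, hvi]
    exact one_ne_zero
  refine ⟨hy, ?_⟩
  have h := (mk_projLift ψ hy).trans hmk.symm
  rw [Projectivization.mk_eq_mk_iff] at h
  obtain ⟨c, hc⟩ := h
  have hci : (c : ℂ) * v i = 1 := by
    have := congrFun hc i
    rw [Pi.smul_apply, projLift_apply_self, Units.smul_def, smul_eq_mul] at this
    exact this
  rw [hvi, mul_one] at hci
  rw [← hc, Units.smul_def, hci, one_smul]

/-! ### A diagonal symmetry and the lifts -/

variable {ψ} {a : Fin (m + 2) → ℂˣ} {Φ : M → M}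
  (hΦ : ∀ x, ψ (Φ x) = Projectivization.mk ℂ (a • (ψ x).rep)
    ((smul_ne_zero_iff_ne a).mpr (Projectivization.rep_nonzero _)))

omit [TopologicalSpace M] [ChartedSpace E M] in
include hΦ in
/-- **A diagonal symmetry preserves the chart domains and scales the lifts**: for `x ∈ Mᵢ`,
`Φ x ∈ Mᵢ` and `Z̃ᵢ (Φ x) = (a_j/a_i)_j · Z̃ᵢ x`. Indeed `ψ x = [t • Z̃ᵢ x]`, so
`ψ (Φ x) = [a • Z̃ᵢ x] = [(a/aᵢ) • Z̃ᵢ x]`, a representative normalised at `i`.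
[cite: Shioda1979HodgeFermat, §1] -/
theorem projLift_symm {i : Fin (m + 2)} {x : M} (hx : x ∈ liftDomain ψ i) :
    Φ x ∈ liftDomain ψ i ∧
      projLift ψ i (Φ x) = (fun j ↦ ((a j : ℂ) / (a i : ℂ))) * projLift ψ i x := by
  set z := projLift ψ i x with hz
  set w : Fin (m + 2) → ℂ := (fun j ↦ ((a j : ℂ) / (a i : ℂ))) * z with hw
  have hai : ((a i : ℂ)) ≠ 0 := (a i).ne_zero
  have hwi : w i = 1 := by
    simp only [hw, Pi.mul_apply, hz, projLift_apply_self, mul_one, div_self hai]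
  have hw0 : w ≠ 0 := fun h ↦ by
    have := congrFun h i
    rw [hwi] at this
    exact one_ne_zero this
  -- `rep (ψ x) = t • z`
  have hrep : ∃ t : ℂ, t ≠ 0 ∧ (ψ x).rep = t • z := by
    have h := (Projectivization.mk_rep (ψ x)).trans (mk_projLift ψ hx).symm
    rw [Projectivization.mk_eq_mk_iff] at h
    obtain ⟨c, hc⟩ := h
    exact ⟨(c : ℂ), c.ne_zero, by rw [← hc, Units.smul_def]⟩
  obtain ⟨t, ht, htz⟩ := hrep
  -- `ψ (Φ x) = [w]`
  have hmk : Projectivization.mk ℂ w hw0 = ψ (Φ x) := by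
    rw [hΦ x, Projectivization.mk_eq_mk_iff']
    refine ⟨(t * (a i : ℂ))⁻¹, ?_⟩
    funext j
    simp only [hw, Pi.smul_apply', Pi.smul_apply, Pi.mul_apply, smul_eq_mul, htz, Units.smul_def]
    field_simp
  exact projLift_eq_of_mk_eq ψ hw0 hmk hwi

omit [TopologicalSpace M] [ChartedSpace E M] in
include hΦ in
/-- `Φ` maps `Mᵢ` into itself. [cite: Shioda1979HodgeFermat, §1] -/
theorem mem_liftDomain_symm {i : Fin (m + 2)} {x : M} (hx : x ∈ liftDomain ψ i) :
    Φ x ∈ liftDomain ψ i :=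
  (projLift_symm hΦ hx).1

include hΦ in
/-- **Chain rule for the lifts under a holomorphic diagonal symmetry**: for `x ∈ Mᵢ`,
`dZ̃ᵢ(Φ x) (dΦ(x) v) = (a/aᵢ) · dZ̃ᵢ(x) v` — both are the differential at `x` of
`Z̃ᵢ ∘ Φ = (a/aᵢ) · Z̃ᵢ` (equal near `x`, `projLift_symm`). [cite: Shioda1979HodgeFermat, §1] -/
theorem liftDeriv_symm_apply (hψ : Continuous ψ) (hhol : HasHolomorphicCoords E ψ)
    (hΦd : MDifferentiable 𝓘(ℂ, E) 𝓘(ℂ, E) Φ) {i : Fin (m + 2)} {x : M} (hx : x ∈ liftDomain ψ i)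
    (v : E) :
    liftDeriv (E := E) ψ i (Φ x) (mfderiv 𝓘(ℂ, E) 𝓘(ℂ, E) Φ x v) =
      (fun j ↦ ((a j : ℂ) / (a i : ℂ))) * liftDeriv (E := E) ψ i x v := by
  set δ : Fin (m + 2) → ℂ := fun j ↦ ((a j : ℂ) / (a i : ℂ)) with hδ
  -- the multiplication by `δ` as a continuous linear map
  set D : (Fin (m + 2) → ℂ) →L[ℂ] (Fin (m + 2) → ℂ) :=
    ContinuousLinearMap.pi fun j ↦ δ j • ContinuousLinearMap.proj j with hD
  have hDapply : ∀ w, D w = δ * w := fun w ↦ by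
    funext j; simp [hD]
  have hΦx : Φ x ∈ liftDomain ψ i := mem_liftDomain_symm hΦ hx
  have hgΦ : MDifferentiableAt 𝓘(ℂ, E) 𝓘(ℂ, Fin (m + 2) → ℂ) (projLift ψ i) (Φ x) :=
    (mdifferentiableOn_projLift ψ hhol i _ hΦx).mdifferentiableAt
      ((isOpen_liftDomain ψ hψ i).mem_nhds hΦx)
  have hg : MDifferentiableAt 𝓘(ℂ, E) 𝓘(ℂ, Fin (m + 2) → ℂ) (projLift ψ i) x :=
    (mdifferentiableOn_projLift ψ hhol i _ hx).mdifferentiableAt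
      ((isOpen_liftDomain ψ hψ i).mem_nhds hx)
  -- `Z̃ᵢ ∘ Φ = D ∘ Z̃ᵢ` near `x`
  have hev : (projLift ψ i ∘ Φ) =ᶠ[𝓝 x] (D ∘ projLift ψ i) := by
    filter_upwards [(isOpen_liftDomain ψ hψ i).mem_nhds hx] with y hy
    simp only [Function.comp_apply, hDapply]
    exact (projLift_symm hΦ hy).2
  have h1 := hgΦ.hasMFDerivAt.comp x (hΦd x).hasMFDerivAt
  have h2 := (D.hasFDerivAt.hasMFDerivAt.comp x hg.hasMFDerivAt).congr_of_eventuallyEq hev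
  have hLL := h1.mfderiv.symm.trans h2.mfderiv
  have key := DFunLike.congr_fun hLL v
  -- `key : dZ̃ᵢ(Φ x) (dΦ(x) v) = D (dZ̃ᵢ(x) v)`, up to the definitional identifications
  exact key.trans (hDapply _)

/-! ### The local residue form under a diagonal symmetry -/

include hΦ in
/-- **`Φ^* ω = (∏_j a_j/a_i) • ω` for the local residue form `ω = det(N_j, Z̃ᵢ, dZ̃ᵢ ·)` on
`Mᵢ`.** Hypotheses: `Φ` holomorphic over `[z] ↦ [a • z]`, `x ∈ Mᵢ`, the normal vector scales as
`N_j(δ • Z̃ᵢ x) = δ • N_j(Z̃ᵢ x)` for `δ = a/aᵢ` (for the Fermat form: `∂_jF(δ z) δ_j = ∂_jF(z)`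
as `δ_jᵐ = 1`), and `ω` is any form agreeing with `residueFormula ψ F 1 i j` at `x` and `Φ x`.
Then `(Φ^*ω)(x) = det(δN, δz, δ dZ̃ᵢ(x) ·) = (∏ δ_j) ω(x)` (`projLift_symm`, `liftDeriv_symm_apply`,
`coneResidue_diag`). In print: `g_a^* Res_{Uᵢ}(Ω/F) = (∏_j a_j/a_i) Res_{Uᵢ}(Ω/F)`, the
character of `μₘⁿ⁺²` on the holomorphic volume form of the affine Fermat variety.
[cite: Shioda1979HodgeFermat, §1 (1.7)] [cite: VoisinHodgeII2003, §6.1.3] -/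
theorem pullback_residueFormula_one_symm (hψ : Continuous ψ) (hhol : HasHolomorphicCoords E ψ)
    (hΦd : MDifferentiable 𝓘(ℂ, E) 𝓘(ℂ, E) Φ) {F : MvPolynomial (Fin (m + 2)) ℂ}
    {i j : Fin (m + 2)} {x : M} (hx : x ∈ liftDomain ψ i)
    (hN : normalVec F ((fun k ↦ ((a k : ℂ) / (a i : ℂ))) * projLift ψ i x) j =
      (fun k ↦ ((a k : ℂ) / (a i : ℂ))) * normalVec F (projLift ψ i x) j)
    {ω₀ : MForm 𝓘(ℝ, E) M ℂ m}
    (hωx : ω₀ x = (show E [⋀^Fin m]→L[ℝ] ℂ from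
      (residueFormula (E := E) ψ F 1 i j x).restrictScalars ℝ))
    (hωΦx : ω₀ (Φ x) = (show E [⋀^Fin m]→L[ℝ] ℂ from
      (residueFormula (E := E) ψ F 1 i j (Φ x)).restrictScalars ℝ)) :
    ω₀.pullback 𝓘(ℝ, E) Φ x = (∏ k, ((a k : ℂ) / (a i : ℂ))) • ω₀ x := by
  set δ : Fin (m + 2) → ℂ := fun k ↦ ((a k : ℂ) / (a i : ℂ)) with hδ
  have hz : projLift ψ i (Φ x) = δ * projLift ψ i x := (projLift_symm hΦ hx).2
  -- the composed differential `dZ̃ᵢ(Φ x) ∘ dΦ(x)` as a plain linear map, scaling by `δ`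
  set T : E →L[ℂ] (Fin (m + 2) → ℂ) := (liftDeriv (E := E) ψ i (Φ x)).comp
    (show E →L[ℂ] E from mfderiv 𝓘(ℂ, E) 𝓘(ℂ, E) Φ x) with hT
  have hTv : ∀ v, T v = δ * liftDeriv (E := E) ψ i x v := fun v ↦
    liftDeriv_symm_apply hΦ hψ hhol hΦd hx v
  have hcone : coneResidue (normalVec F (projLift ψ i (Φ x)) j) (projLift ψ i (Φ x)) T =
      (∏ k, δ k) • coneResidue (normalVec F (projLift ψ i x) j) (projLift ψ i x)
        (liftDeriv (E := E) ψ i x) := by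
    rw [hz, hN]
    exact coneResidue_diag δ _ _ _ T hTv
  -- evaluate both sides on `v`
  ext v
  have hreal := mfderiv_real_eq_restrictScalars (hΦd x)
  have lhs : ω₀.pullback 𝓘(ℝ, E) Φ x v =
      coneResidue (normalVec F (projLift ψ i (Φ x)) j) (projLift ψ i (Φ x)) T v := by
    rw [MForm.pullback_apply, hωΦx, hreal]
    change (residueFormula (E := E) ψ F 1 i j (Φ x)) (fun k ↦ mfderiv 𝓘(ℂ, E) 𝓘(ℂ, E) Φ x (v k)) = _
    rw [residueFormula, map_one, one_smul, coneResidue_apply, coneResidue_apply]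
    rfl
  have rhs : ((∏ k, δ k) • ω₀ x) v =
      ((∏ k, δ k) • coneResidue (normalVec F (projLift ψ i x) j) (projLift ψ i x)
        (liftDeriv (E := E) ψ i x)) v := by
    rw [ContinuousAlternatingMap.smul_apply, ContinuousAlternatingMap.smul_apply, hωx]
    change (∏ k, δ k) • (residueFormula (E := E) ψ F 1 i j x) v = _
    rw [residueFormula, map_one, one_smul]
  rw [lhs, rhs, hcone]

/-! ### Eigenforms: the ratio function under the symmetry -/

omit hΦ in
/-- **The quotient of two eigenforms transforms by the quotient of the characters.** If on a
`Φ`-stable set `S` the forms satisfy `η x = f x • ω x` with `ω x ≠ 0`, and `Φ^*η = χ • η`,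
`Φ^*ω = c • ω` pointwise on `S`, then `f (Φ x) · c = χ · f x` for `x ∈ S`: evaluate
`(Φ^*η)(x) = f(Φ x) (Φ^*ω)(x) = f(Φ x) c ω(x)` against `χ η(x) = χ f(x) ω(x)`.
[cite: Shioda1979HodgeFermat, §1 (1.7)] -/
theorem ratio_symm {k : ℕ} {S : Set M} (hS : ∀ x ∈ S, Φ x ∈ S) {η ω₀ : MForm 𝓘(ℝ, E) M ℂ k}
    {f : M → ℂ} (hf : ∀ x ∈ S, η x = f x • ω₀ x) (hω : ∀ x ∈ S, ω₀ x ≠ 0) {χ c : ℂ}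
    (hη : ∀ x ∈ S, η.pullback 𝓘(ℝ, E) Φ x = χ • η x)
    (hc : ∀ x ∈ S, ω₀.pullback 𝓘(ℝ, E) Φ x = c • ω₀ x) {x : M} (hx : x ∈ S) :
    f (Φ x) * c = χ * f x := by
  have h1 : η.pullback 𝓘(ℝ, E) Φ x = f (Φ x) • ω₀.pullback 𝓘(ℝ, E) Φ x := by
    ext v
    rw [MForm.pullback_apply, hf _ (hS x hx), ContinuousAlternatingMap.smul_apply,
      ContinuousAlternatingMap.smul_apply, MForm.pullback_apply]
  rw [hη x hx, hc x hx, hf x hx, smul_smul, smul_smul] at h1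
  -- `(χ f x) • ω₀ x = (f (Φ x) c) • ω₀ x` with `ω₀ x ≠ 0`
  have h2 : (χ * f x - f (Φ x) * c) • ω₀ x = 0 := by rw [sub_smul, h1, sub_self]
  rcases smul_eq_zero.1 h2 with h | h
  · exact (sub_eq_zero.1 h).symm
  · exact absurd h (hω x hx)

end Model

end Literature.AlgebraicGeometry.HodgeTheory

end
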